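import Summits.MatrixMultiplication.MatrixMultiplication.Theorems.ObstructionDescentInvariantTower

set_option linter.dupNamespace false

/-!
# Two witness points decide the invariant tower above `ω(ℂ)` (decomp-mm · lens 3 · gen 11, hand theorem H7 made kernel)

Route `route-MatrixMultiplication-ObstructionDescent`, support for the aside `InvariantSaturation` (item
`stmt-MatrixMultiplication-32282`); continues `ObstructionDescentInvariantTower` (levels, `passLevels`, `pointLevels`, H6).

**Witness principle.**  Every zero-padded tensor `w` of rank `≤ m` is a point `[A|B|C]` of `Mat_m³·⟨m⟩`
(`exists_fromCols_eq_padTensor`), and `GL_m³·⟨m⟩` is dense there (landed calculus), so a polynomial non-zero at such a point does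
not vanish on the orbit: `pointLevels N (pad w) ⊆ passLevels m N` whenever `R(w) ≤ m` (`pointLevels_padTensor_subset_passLevels`).
Gen 10 used the witness point `⟨n²⟩` (hypothesis (U)); its stabiliser period is `2` (Bürgisser–Ikenmeyer 2017, Thm 5.3 with
Ex. 4.13), so it certifies EVEN levels only and the primitive ODD levels (P) remained statements about `σ_m`.  Gen 11 adds the
second witness point: the matrix multiplication tensor `⟨n,n,n⟩` ITSELF, right-aligned into the format `m` (`padMMLast`) — period
`1`, polystable (BI17 Cor 4.9, p.16), and of rank `≤ n^τ ≤ m` for every `τ > ω(ℂ)` eventually (`eventually_rank_le_rpow_of_omega_lt`).  Hence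
the hypothesis
* (MM) every non-empty ODD level `k ∈ [n, 2n)` of degree `k n² > m` has a weight vector NON-ZERO AT `⟨n,n,n⟩` (`k = n`:
  `F_n(⟨n,n,n⟩) ≠ 0`, BI17 Prop 5.24 / Cor 5.25(3); data `n = 2`: `F_2(⟨2,2,2⟩) = 864` and the level-3 invariant has
  `G(⟨2,2,2⟩) = 720`, so `E'(⟨2,2,2⟩) = E'(4) = ℕ ∖ {1}` and (MM) holds at `n = 2` for every `m`)
REPLACES (P) as soon as `R(⟨n,n,n⟩) ≤ m`: **H7** `tower_of_matMulLevels` (cell), `invariantSaturation_omega_of_matMulLevels` (every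
scale `τ > ω(ℂ)`), `invariantSaturation_record_of_matMulLevels` (`2.37295 < τ < 4`, via the in-tree record `LeGall2014_cw4_omega_le`),
and under the summit itself the four point hypotheses give the whole item (`invariantSaturation_of_matMulLevels_of_summit`): the
content of the tower beyond the two witness points is concentrated at the scales `(2, ω(ℂ)]`.  No hypothesis about `σ_m` remains
anywhere in `(2.37295, 4)`.  Since secant varieties are closed, the witness principle
holds for BORDER rank: `pointLevels_padTensor_subset_passLevels_of_mem_closure` (w in the Euclidean closure of rank `≤ m`) and,
under the tree's Alder–Strassen fact, `…_of_algBorderRank_le` (`R̲(w) ≤ m`); the converse (a level passes ONLY through corner points of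
rank `≤ m`) is `ObstructionDescentSecantLevels`.  All hypotheses are stated inline; no proposition is defined; no `sorry`; standard axioms.
[cite: BurgisserIkenmeyer2017, §5 (5.2), Thm 5.3, Cor 4.9, Prop 5.24, Cor 5.25; BurgisserIkenmeyer2011, §2 (2.2), Lemma 3.2;
Blaser2013, Def 5.1; LeGall2014, Table 2]
-/

noncomputable section

open scoped BigOperators
open Finset Filter Asymptotics

namespace Summit.MatrixMultiplication.MatrixMultiplication.Theorems.ObstructionCalculus

section WitnessPoint

open Literature.Computability.AlgebraicComplexity (tensorRank matMulTensor unitTensor triad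
  exists_eq_sum_triad_of_tensorRank_le)

variable {m : ℕ} {ι : Type} [Fintype ι] [DecidableEq ι]

/-- **Witness principle, set-up.**  Any tensor `w` on `ι³` of rank `≤ m`, zero-padded into the format `m` along an index map
`e : ι → Fin m`, is a point `[A|B|C]` of `Mat_m³·⟨m⟩` (the columns are the padded factors of a length-`m` decomposition).
[cite: BurgisserIkenmeyer2011, §2 (2.2)] -/
theorem exists_fromCols_eq_padTensor (e : ι → Fin m) {w : ι → ι → ι → ℂ} (hr : tensorRank w ≤ m) :
    ∃ A B C : Matrix (Fin m) (Fin m) ℂ, padTensor e w = fromCols A B C := by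
  obtain ⟨x, y, z, hdec⟩ := exists_eq_sum_triad_of_tensorRank_le hr
  refine ⟨fun a l => padVec e (x l) a, fun b l => padVec e (y l) b, fun c l => padVec e (z l) c, ?_⟩
  rw [hdec, padTensor_sum]
  simp only [padTensor_triad]
  rfl

/-- **Witness principle.**  A polynomial non-zero at some zero-padded tensor of rank `≤ m` does not vanish on `GL_m³·⟨m⟩`.
[this node] -/
theorem not_mem_orbitVanishing_of_witness (e : ι → Fin m) {w : ι → ι → ι → ℂ} (hr : tensorRank w ≤ m)
    {f : MvPolynomial (Idx m) ℂ} (hf : evalT (padTensor e w) f ≠ 0) : f ∉ orbitVanishing (unitTensor ℂ m) := by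
  obtain ⟨A, B, C, hABC⟩ := exists_fromCols_eq_padTensor e hr
  intro hmem
  rw [hABC] at hf
  exact hf (evalT_fromCols_eq_zero_of_mem_orbitVanishing hmem A B C)

/-- **Witness principle, level form.**  The levels of a zero-padded tensor of rank `≤ m` all pass. [this node] -/
theorem pointLevels_padTensor_subset_passLevels (N : ℕ) (e : ι → Fin m) {w : ι → ι → ι → ℂ}
    (hr : tensorRank w ≤ m) : pointLevels N (padTensor e w) ⊆ passLevels m N := by
  rintro k ⟨f, hf, hval⟩ hle
  exact not_mem_orbitVanishing_of_witness e hr hval (hle hf)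

/-! ### The second witness point: `⟨n,n,n⟩` right-aligned into the format `m` -/

/-- The RIGHT-aligned index embedding `Fin n × Fin n → Fin m`, `(i,j) ↦ (m − n²) + (i·n + j)`, onto the last `n²` coordinates
(where the live label `rectType m (n²) k` carries its weight). [bookkeeping] -/
def padIdxLast (n m : ℕ) (h : n * n ≤ m) : Fin n × Fin n → Fin m :=
  fun q => ⟨m - n * n + (finProdFinEquiv q : ℕ), by have := (finProdFinEquiv q).isLt; omega⟩

/-- `padIdxLast` lands in the last `n²` coordinates. [bookkeeping] -/
theorem le_padIdxLast_add (n m : ℕ) (h : n * n ≤ m) (q : Fin n × Fin n) :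
    m ≤ (padIdxLast n m h q : ℕ) + n * n := by
  simp only [padIdxLast]
  omega

/-- `padIdxLast` is injective. [bookkeeping] -/
theorem padIdxLast_injective (n m : ℕ) (h : n * n ≤ m) : Function.Injective (padIdxLast n m h) := by
  intro q q' hqq'
  have hv : (padIdxLast n m h q : ℕ) = (padIdxLast n m h q' : ℕ) := by rw [hqq']
  simp only [padIdxLast] at hv
  exact finProdFinEquiv.injective (Fin.ext (by omega))

/-- `⟨n,n,n⟩` zero-padded onto the LAST `n²` coordinates of each slot of the format `m`. [cite: BurgisserIkenmeyer2011, §5] -/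
def padMMLast (n m : ℕ) (h : n * n ≤ m) : Tensor ℂ m :=
  padTensor (padIdxLast n m h) (matMulTensor ℂ n n n)

/-- If `R(⟨n,n,n⟩) ≤ m` the right-aligned padded tensor is a point `[A|B|C]` of `Mat_m³·⟨m⟩`.
[cite: BurgisserIkenmeyer2011, §2 (2.2)] -/
theorem exists_fromCols_eq_padMMLast {n : ℕ} (h : n * n ≤ m) (hr : tensorRank (matMulTensor ℂ n n n) ≤ m) :
    ∃ A B C : Matrix (Fin m) (Fin m) ℂ, padMMLast n m h = fromCols A B C :=
  exists_fromCols_eq_padTensor (padIdxLast n m h) hr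

/-- The levels of the padded `⟨n,n,n⟩` pass as soon as `R(⟨n,n,n⟩) ≤ m`. [this node] -/
theorem pointLevels_padMMLast_subset_passLevels {n : ℕ} (h : n * n ≤ m) (hr : tensorRank (matMulTensor ℂ n n n) ≤ m) :
    pointLevels (n * n) (padMMLast n m h) ⊆ passLevels m (n * n) :=
  pointLevels_padTensor_subset_passLevels (n * n) (padIdxLast n m h) hr

/-- **H7 (cell theorem): two witness points decide the tower.**  At a cell `(n, m)` with `R(⟨n,n,n⟩) ≤ m` the tower — every level of
degree `> m` passes or is empty — follows from (K0) empty low levels, (U) even levels at the point `⟨n²⟩`, (Ko) a small non-empty odd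
level, and (MM) every non-empty odd level `k ∈ [n, 2n)` of degree `> m` is a level of the point `⟨n,n,n⟩` — four statements none of
which mentions `σ_m`. [cite: BurgisserIkenmeyer2017, Prop 5.24, Cor 5.25] -/
theorem tower_of_matMulLevels (n : ℕ) (h : n * n ≤ m) (hr : tensorRank (matMulTensor ℂ n n n) ≤ m)
    (hK0 : ∀ k : ℕ, 0 < k → k < n → k ∈ emptyLevels m (n * n))
    (hU : ∀ e : ℕ, Even e → n ≤ e → e ∈ pointLevels (n * n) (padUnitLast m (n * n)))
    (hKo : ∃ o : ℕ, Odd o ∧ n ≤ o ∧ o ≤ n + 1 ∧ o ∉ emptyLevels m (n * n))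
    (hMM : ∀ k : ℕ, Odd k → n ≤ k → k < 2 * n → m < k * (n * n) → k ∉ emptyLevels m (n * n) →
      k ∈ pointLevels (n * n) (padMMLast n m h)) :
    ∀ k : ℕ, m < k * (n * n) → k ∈ passLevels m (n * n) ∪ emptyLevels m (n * n) :=
  tower_of_levels n hK0 hU hKo fun k hk hnk hk2 hkm hW =>
    pointLevels_padMMLast_subset_passLevels h hr (hMM k hk hnk hk2 hkm hW)

/-- At the cubic scale `n³ ≤ m` the rank hypothesis of H7 is free (standard algorithm). [cite: Blaser2013, §5] -/
theorem tower_of_matMulLevels_cubic (n : ℕ) (h : n * n ≤ m) (hm : n * n * n ≤ m)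
    (hK0 : ∀ k : ℕ, 0 < k → k < n → k ∈ emptyLevels m (n * n))
    (hU : ∀ e : ℕ, Even e → n ≤ e → e ∈ pointLevels (n * n) (padUnitLast m (n * n)))
    (hKo : ∃ o : ℕ, Odd o ∧ n ≤ o ∧ o ≤ n + 1 ∧ o ∉ emptyLevels m (n * n))
    (hMM : ∀ k : ℕ, Odd k → n ≤ k → k < 2 * n → m < k * (n * n) → k ∉ emptyLevels m (n * n) →
      k ∈ pointLevels (n * n) (padMMLast n m h)) :
    ∀ k : ℕ, m < k * (n * n) → k ∈ passLevels m (n * n) ∪ emptyLevels m (n * n) :=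
  tower_of_matMulLevels n h ((Literature.Computability.AlgebraicComplexity.tensorRank_matMulTensor_le ℂ n n n).trans hm)
    hK0 hU hKo hMM

end WitnessPoint

/-! ### Border rank suffices: the passing condition is closed -/

section SecantClosure

open Literature.Computability.AlgebraicComplexity (tensorRank matMulTensor algBorderRank
  alder_secantVariety_eq_setOf_algBorderRank_le mem_closure_setOf_tensorRank_le_iff)

variable {m : ℕ} {ι : Type} [Fintype ι] [DecidableEq ι]

omit [DecidableEq ι] in
/-- `w ↦ f(pad_e w)` is continuous (a polynomial in the entries). [bookkeeping] -/
theorem continuous_evalT_padTensor (e : ι → Fin m) (f : MvPolynomial (Idx m) ℂ) :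
    Continuous fun w : ι → ι → ι → ℂ => evalT (padTensor e w) f := by
  have hco : Continuous fun w : ι → ι → ι → ℂ => fun p : Idx m => padTensor e w p.1 p.2.1 p.2.2 := by
    refine continuous_pi fun p => ?_
    unfold padTensor
    refine continuous_finsetSum _ fun q _ => continuous_const.mul ?_
    exact (continuous_apply q.2.2).comp ((continuous_apply q.2.1).comp (continuous_apply q.1))
  have h := (MvPolynomial.continuous_eval f).comp hco
  refine h.congr fun w => ?_
  simp only [Function.comp, evalT, ← MvPolynomial.aeval_eq_eval]

/-- **Border-rank witness principle (closure form).**  If a weight vector of level `k` is non-zero at `pad_e w` for a tensor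
`w` in the Euclidean CLOSURE of the tensors of rank `≤ m`, then `k` passes: the non-vanishing locus is open and meets the
rank-`≤ m` tensors, where `pointLevels_padTensor_subset_passLevels` applies. [this node] -/
theorem pointLevels_padTensor_subset_passLevels_of_mem_closure (N : ℕ) (e : ι → Fin m) {w : ι → ι → ι → ℂ}
    (hw : w ∈ closure {s : ι → ι → ι → ℂ | tensorRank s ≤ m}) :
    pointLevels N (padTensor e w) ⊆ passLevels m N := by
  rintro k ⟨f, hfW, hne⟩
  have hopen : IsOpen {w' : ι → ι → ι → ℂ | evalT (padTensor e w') f ≠ 0} :=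
    isOpen_ne_fun (continuous_evalT_padTensor e f) continuous_const
  obtain ⟨w', hw'ne, hw'S⟩ := mem_closure_iff.1 hw _ hopen hne
  exact pointLevels_padTensor_subset_passLevels N e hw'S ⟨f, hfW, hw'ne⟩

/-- **Border-rank witness principle.**  Under the tree's Alder–Strassen fact (`closure {R ≤ m} = {R̲ ≤ m}` over `ℂ`,
`mem_closure_setOf_tensorRank_le_iff`): `pointLevels N (pad_e w) ⊆ passLevels m N` whenever `R̲(w) ≤ m`.
[cite: BurgisserClausenShokrollahi1997, Thm. (20.3)] -/
theorem pointLevels_padTensor_subset_passLevels_of_algBorderRank_le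
    (hA : alder_secantVariety_eq_setOf_algBorderRank_le) (N : ℕ) (e : ι → Fin m) {w : ι → ι → ι → ℂ}
    (hw : algBorderRank w ≤ m) : pointLevels N (padTensor e w) ⊆ passLevels m N :=
  pointLevels_padTensor_subset_passLevels_of_mem_closure N e ((mem_closure_setOf_tensorRank_le_iff hA m w).2 hw)

/-- The second witness point with BORDER rank: `pointLevels n² (padMMLast n m h) ⊆ passLevels m n²` as soon as
`R̲(⟨n,n,n⟩) ≤ m` (under the Alder–Strassen fact). [this node] -/
theorem pointLevels_padMMLast_subset_passLevels_of_algBorderRank_le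
    (hA : alder_secantVariety_eq_setOf_algBorderRank_le) {n : ℕ} (h : n * n ≤ m)
    (hr : algBorderRank (matMulTensor ℂ n n n) ≤ m) :
    pointLevels (n * n) (padMMLast n m h) ⊆ passLevels m (n * n) :=
  pointLevels_padTensor_subset_passLevels_of_algBorderRank_le hA (n * n) (padIdxLast n m h) hr

end SecantClosure

end Summit.MatrixMultiplication.MatrixMultiplication.Theorems.ObstructionCalculus

/-! ### H7 at tree level: the tower above `ω(ℂ)`, above the record, and under the summit -/

namespace Summit.MatrixMultiplication.MatrixMultiplication.Theses.ObstructionDescent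

open Summit.MatrixMultiplication.MatrixMultiplication.Theorems.ObstructionCalculus
open Literature.Computability.AlgebraicComplexity (tensorRank matMulTensor unitTensor omega admissibleExponents
  admissibleExponents_nonempty mem_admissibleExponents_of_le)

/-- For every `τ > ω(ℂ)`, eventually `R(⟨n,n,n⟩) ≤ n^τ`: pick `ω(ℂ) < β < τ`, an admissible `γ < β` below it (infimum), so `β` is
admissible (upward closure), and absorb the `O`-constant into `n^{τ-β} → ∞`. [cite: Blaser2013, Def 5.1] -/
theorem eventually_rank_le_rpow_of_omega_lt {τ : ℝ} (hτ : omega ℂ < τ) :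
    ∃ n₀ : ℕ, ∀ n : ℕ, n₀ ≤ n → (tensorRank (matMulTensor ℂ n n n) : ℝ) ≤ (n : ℝ) ^ τ := by
  obtain ⟨β, hωβ, hβτ⟩ := exists_between hτ
  obtain ⟨γ, hγ, hγβ⟩ := exists_lt_of_csInf_lt (admissibleExponents_nonempty ℂ) hωβ
  have hβ : β ∈ admissibleExponents ℂ := mem_admissibleExponents_of_le ℂ hγ hγβ.le
  obtain ⟨c, _hc, hcw⟩ := hβ.exists_pos
  obtain ⟨N, hN⟩ := eventually_atTop.1 hcw.bound
  have ht : Tendsto (fun n : ℕ => (n : ℝ) ^ (τ - β)) atTop atTop :=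
    (tendsto_rpow_atTop (by linarith)).comp tendsto_natCast_atTop_atTop
  obtain ⟨N', hN'⟩ := eventually_atTop.1 (ht.eventually_ge_atTop c)
  refine ⟨max N (max N' 1), fun n hn => ?_⟩
  have hnN : N ≤ n := le_trans (le_max_left _ _) hn
  have hnN' : N' ≤ n := le_trans ((le_max_left _ _).trans (le_max_right _ _)) hn
  have hn1 : (1 : ℝ) ≤ n := by
    exact_mod_cast le_trans ((le_max_right _ _).trans (le_max_right _ _)) hn
  have hpos : (0 : ℝ) < n := by linarith
  have h1 := hN n hnN
  rw [Real.norm_of_nonneg (Nat.cast_nonneg _),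
    Real.norm_of_nonneg (Real.rpow_nonneg (Nat.cast_nonneg _) _)] at h1
  have hc' : c ≤ (n : ℝ) ^ (τ - β) := hN' n hnN'
  calc (tensorRank (matMulTensor ℂ n n n) : ℝ) ≤ c * (n : ℝ) ^ β := h1
    _ ≤ (n : ℝ) ^ (τ - β) * (n : ℝ) ^ β := by
        gcongr
    _ = (n : ℝ) ^ τ := by
        rw [← Real.rpow_add hpos, sub_add_cancel]

/-- **H7 (tower theorem): above `ω(ℂ)` the invariant tower is decided by the two witness points `⟨n²⟩` and `⟨n,n,n⟩`.**  If (K0),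
(U), (Ko), (MM) hold eventually in `n`, uniformly in `m ≥ n²`, then the level reading of the tower holds at every scale
`ω(ℂ) < τ < 4`: for such `τ`, `R(⟨n,n,n⟩) ≤ n^τ ≤ m` eventually, so `⟨n,n,n⟩` is a point of `σ_m` and (MM) gives (P). PROVED.
[this node] -/
theorem invariantSaturation_omega_of_matMulLevels
    (h : ∃ n₁ : ℕ, ∀ n m : ℕ, n₁ ≤ n → ∀ hnm : n * n ≤ m,
      (∀ k : ℕ, 0 < k → k < n → k ∈ emptyLevels m (n * n)) ∧
      (∀ e : ℕ, Even e → n ≤ e → e ∈ pointLevels (n * n) (padUnitLast m (n * n))) ∧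
      (∃ o : ℕ, Odd o ∧ n ≤ o ∧ o ≤ n + 1 ∧ o ∉ emptyLevels m (n * n)) ∧
      (∀ k : ℕ, Odd k → n ≤ k → k < 2 * n → m < k * (n * n) → k ∉ emptyLevels m (n * n) →
        k ∈ pointLevels (n * n) (padMMLast n m hnm))) :
    ∀ τ : ℝ, omega ℂ < τ → τ < 4 → ∃ n₀ : ℕ, ∀ n m : ℕ, n₀ ≤ n → n * n ≤ m → (n : ℝ) ^ τ ≤ (m : ℝ) →
      ∀ k : ℕ, m < k * (n * n) → k ∈ passLevels m (n * n) ∪ emptyLevels m (n * n) := by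
  obtain ⟨n₁, h⟩ := h
  intro τ hτ _
  obtain ⟨n₂, hn₂⟩ := eventually_rank_le_rpow_of_omega_lt hτ
  refine ⟨max n₁ n₂, fun n m hn hnm hτm => ?_⟩
  obtain ⟨hK0, hU, hKo, hMM⟩ := h n m (le_trans (le_max_left _ _) hn) hnm
  have hr : tensorRank (matMulTensor ℂ n n n) ≤ m := by
    have h1 := hn₂ n (le_trans (le_max_right _ _) hn)
    exact_mod_cast h1.trans hτm
  exact tower_of_matMulLevels n hnm hr hK0 hU hKo hMM

/-- **H7 (record form): for `2.37295 < τ < 4` the tower follows from (K0), (U), (Ko), (MM)** — the in-tree record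
`ω(ℂ) ≤ 2.37295` puts `⟨n,n,n⟩` inside `σ_{n^τ}`.  Compare H6b: for `3 < τ < 4` the three hypotheses (K0), (U), (Ko) suffice;
(MM) buys the octave `(2.37295, 3]`. PROVED. [cite: LeGall2014, Table 2] -/
theorem invariantSaturation_record_of_matMulLevels
    (h : ∃ n₁ : ℕ, ∀ n m : ℕ, n₁ ≤ n → ∀ hnm : n * n ≤ m,
      (∀ k : ℕ, 0 < k → k < n → k ∈ emptyLevels m (n * n)) ∧
      (∀ e : ℕ, Even e → n ≤ e → e ∈ pointLevels (n * n) (padUnitLast m (n * n))) ∧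
      (∃ o : ℕ, Odd o ∧ n ≤ o ∧ o ≤ n + 1 ∧ o ∉ emptyLevels m (n * n)) ∧
      (∀ k : ℕ, Odd k → n ≤ k → k < 2 * n → m < k * (n * n) → k ∉ emptyLevels m (n * n) →
        k ∈ pointLevels (n * n) (padMMLast n m hnm))) :
    ∀ τ : ℝ, (2.37295 : ℝ) < τ → τ < 4 → ∃ n₀ : ℕ, ∀ n m : ℕ, n₀ ≤ n → n * n ≤ m → (n : ℝ) ^ τ ≤ (m : ℝ) →
      ∀ k : ℕ, m < k * (n * n) → k ∈ passLevels m (n * n) ∪ emptyLevels m (n * n) :=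
  fun τ hτ h4 => invariantSaturation_omega_of_matMulLevels h τ
    (lt_of_le_of_lt (Literature.Computability.AlgebraicComplexity.LeGall2014_cw4_omega_le ℂ) hτ) h4

/-- **The self-improving reading (CONDITIONAL; credits nothing by itself).**  Under the summit itself (`ω(ℂ) = 2`) the four
point hypotheses give the WHOLE item `InvariantSaturation` (`2 < τ < 4`): the tower's content beyond the two witness points is
concentrated exactly at the scales `(2, ω(ℂ)]`. [this node] -/
theorem invariantSaturation_of_matMulLevels_of_summit (hS : _root_.MatrixMultiplication)
    (h : ∃ n₁ : ℕ, ∀ n m : ℕ, n₁ ≤ n → ∀ hnm : n * n ≤ m,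
      (∀ k : ℕ, 0 < k → k < n → k ∈ emptyLevels m (n * n)) ∧
      (∀ e : ℕ, Even e → n ≤ e → e ∈ pointLevels (n * n) (padUnitLast m (n * n))) ∧
      (∃ o : ℕ, Odd o ∧ n ≤ o ∧ o ≤ n + 1 ∧ o ∉ emptyLevels m (n * n)) ∧
      (∀ k : ℕ, Odd k → n ≤ k → k < 2 * n → m < k * (n * n) → k ∉ emptyLevels m (n * n) →
        k ∈ pointLevels (n * n) (padMMLast n m hnm))) :
    InvariantSaturation := by
  have hω : omega ℂ = 2 := MatrixMultiplication_iff.1 hS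
  have h2 := invariantSaturation_omega_of_matMulLevels h
  rw [hω] at h2
  exact invariantSaturation_iff_levels.2 h2

end Summit.MatrixMultiplication.MatrixMultiplication.Theses.ObstructionDescent

end
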